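import Mathlib.RingTheory.Nullstellensatz
import Mathlib.Algebra.MvPolynomial.Equiv
import Literature.NumberTheory.Transcendental.ExpDominantSolvability
import HarnessLib

/-!
# Coordinates for the fibration principle: the tower `F[x', y'][U][V]` and the fibre set

Zilber's Exponential-Algebraic Closedness, case ladder (host summit Schanuel, cell `pub-schanuel`,
seat 2, gen 5).  Bookkeeping for `ZilberEacFibration.lean`.

Coordinates of `F^{d+1} × F^{d+1}` are indexed by `σ = Fin (d+1) ⊕ Fin (d+1)`; the "small"
coordinates (all but `x_last, y_last`) by `τ = Fin d ⊕ Fin d`.  A point of the big space is glued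
from a small point `p : τ → L` and the two last coordinates `a` (`x_last`) and `b` (`y_last`) as
`Sum.elim (Fin.snoc (p ∘ inl) a) (Fin.snoc (p ∘ inr) b)`.

* `aeval_fibreLift₁` / `aeval_fibreLift₂`: the `F`-algebra maps
  `F[X_σ] → F[X_τ][U][V]` sending `x_last ↦ U` (middle), `y_last ↦ V` (outer) — resp. the other way
  round — are compatible with gluing points: evaluating the image of `H` at `(p, a, b)` is evaluating
  `H` at the glued point.  (These maps are written inline as `MvPolynomial.aeval` of an explicit
  coordinate assignment; no new definitions.)
* `isZariskiClosed_fibre`: for an ideal `P ⊆ F[X_σ]` and a small point `p`, the FIBRE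
  `{w ∈ F^{1} × F^{1} | glue(p, w₀, w₁) ∈ Z(P)}` is Zariski closed in `F^{1 ⊕ 1}`.
* `eq_zero_of_infinite_eval_eq_zero` / `hasDominantAddProjection_of_infinite_fst`: a one-variable
  polynomial with infinitely many zeros vanishes; hence a subset of `F^{1} × F^{1}` with infinitely
  many first coordinates has dominant additive projection.

Honest framing: bookkeeping only; nothing about `EC(3,2)` (OPEN) or Schanuel's conjecture is
asserted here.
-/

noncomputable section

open MvPolynomial
open Literature.NumberTheory.Transcendental

set_option linter.dupNamespace false

namespace Summit.Schanuel.Schanuel.Theorems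

variable {F : Type*} [Field F] {d : ℕ}

/-! ## Gluing points and the two tower maps -/

section Glue

/-- The glued point restricted to the small coordinates is `p`. [folklore] -/
theorem glue_comp_castSucc {L : Type*} (p : Fin d ⊕ Fin d → L) (a b : L) :
    (fun t : Fin d ⊕ Fin d => (Sum.elim (Fin.snoc (fun i => p (Sum.inl i)) a)
        (Fin.snoc (fun i => p (Sum.inr i)) b) : Fin (d + 1) ⊕ Fin (d + 1) → L)
          (Sum.map Fin.castSucc Fin.castSucc t)) = p := by
  funext t
  rcases t with i | i
  · simp only [Sum.map_inl, Sum.elim_inl, Fin.snoc_castSucc]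
  · simp only [Sum.map_inr, Sum.elim_inr, Fin.snoc_castSucc]

/-- Gluing the restriction of `z` with its own last coordinates gives back `z`. [folklore] -/
theorem glue_restrict_self {L : Type*} (z : Fin (d + 1) ⊕ Fin (d + 1) → L) :
    (Sum.elim (Fin.snoc (fun i => z (Sum.inl (Fin.castSucc i))) (z (Sum.inl (Fin.last d))))
        (Fin.snoc (fun i => z (Sum.inr (Fin.castSucc i))) (z (Sum.inr (Fin.last d)))) :
          Fin (d + 1) ⊕ Fin (d + 1) → L) = z := by
  funext j
  rcases j with k | k
  · simp only [Sum.elim_inl]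
    exact congrFun (Fin.snoc_init_self (fun k => z (Sum.inl k))) k
  · simp only [Sum.elim_inr]
    exact congrFun (Fin.snoc_init_self (fun k => z (Sum.inr k))) k

variable {L : Type*} [CommRing L] [Algebra F L]

/-- **Tower map 1** (`x_last ↦ U` middle, `y_last ↦ V` outer) is compatible with gluing: evaluating
the image of `H ∈ F[X_σ]` in `F[X_τ][U][V]` at `X_τ ↦ p`, `U ↦ a`, `V ↦ b` is `H(glue(p, a, b))`.
[folklore] -/
theorem aeval_fibreLift₁ (p : Fin d ⊕ Fin d → L) (a b : L)
    (H : MvPolynomial (Fin (d + 1) ⊕ Fin (d + 1)) F) :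
    (Polynomial.eval₂RingHom (Polynomial.eval₂RingHom
        (MvPolynomial.aeval (R := F) p : MvPolynomial (Fin d ⊕ Fin d) F →+* L) a) b)
      (MvPolynomial.aeval (R := F)
        (Sum.elim (Fin.snoc (fun i => Polynomial.C (Polynomial.C (X (Sum.inl i)))) (Polynomial.C Polynomial.X))
          (Fin.snoc (fun i => Polynomial.C (Polynomial.C (X (Sum.inr i)))) Polynomial.X) :
          Fin (d + 1) ⊕ Fin (d + 1) → Polynomial (Polynomial (MvPolynomial (Fin d ⊕ Fin d) F))) H) =
    MvPolynomial.aeval (Sum.elim (Fin.snoc (fun i => p (Sum.inl i)) a)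
        (Fin.snoc (fun i => p (Sum.inr i)) b) : Fin (d + 1) ⊕ Fin (d + 1) → L) H := by
  revert H
  refine fun H => DFunLike.congr_fun (f := (Polynomial.eval₂RingHom (Polynomial.eval₂RingHom
        (MvPolynomial.aeval (R := F) p : MvPolynomial (Fin d ⊕ Fin d) F →+* L) a) b).comp
      (MvPolynomial.aeval (R := F)
        (Sum.elim (Fin.snoc (fun i => Polynomial.C (Polynomial.C (X (Sum.inl i)))) (Polynomial.C Polynomial.X))
          (Fin.snoc (fun i => Polynomial.C (Polynomial.C (X (Sum.inr i)))) Polynomial.X) :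
          Fin (d + 1) ⊕ Fin (d + 1) → Polynomial (Polynomial (MvPolynomial (Fin d ⊕ Fin d) F))) :
            MvPolynomial (Fin (d + 1) ⊕ Fin (d + 1)) F →+* _))
    (g := (MvPolynomial.aeval (R := F) (Sum.elim (Fin.snoc (fun i => p (Sum.inl i)) a)
        (Fin.snoc (fun i => p (Sum.inr i)) b) : Fin (d + 1) ⊕ Fin (d + 1) → L) : _ →+* L)) ?_ H
  refine MvPolynomial.ringHom_ext (fun c => ?_) (fun j => ?_)
  · rw [RingHom.comp_apply, RingHom.coe_coe, RingHom.coe_coe, MvPolynomial.aeval_C,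
      MvPolynomial.aeval_C, Polynomial.algebraMap_apply, Polynomial.algebraMap_apply,
      MvPolynomial.algebraMap_eq, Polynomial.coe_eval₂RingHom, Polynomial.eval₂_C,
      Polynomial.coe_eval₂RingHom, Polynomial.eval₂_C, RingHom.coe_coe, MvPolynomial.aeval_C]
  · rw [RingHom.comp_apply, RingHom.coe_coe, RingHom.coe_coe, MvPolynomial.aeval_X,
      MvPolynomial.aeval_X]
    rcases j with k | k
    · simp only [Sum.elim_inl]
      rcases Fin.eq_castSucc_or_eq_last k with ⟨i, rfl⟩ | rfl
      · rw [Fin.snoc_castSucc, Fin.snoc_castSucc, Polynomial.coe_eval₂RingHom, Polynomial.eval₂_C,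
          Polynomial.coe_eval₂RingHom, Polynomial.eval₂_C, RingHom.coe_coe, MvPolynomial.aeval_X]
      · rw [Fin.snoc_last, Fin.snoc_last, Polynomial.coe_eval₂RingHom, Polynomial.eval₂_C,
          Polynomial.coe_eval₂RingHom, Polynomial.eval₂_X]
    · simp only [Sum.elim_inr]
      rcases Fin.eq_castSucc_or_eq_last k with ⟨i, rfl⟩ | rfl
      · rw [Fin.snoc_castSucc, Fin.snoc_castSucc, Polynomial.coe_eval₂RingHom, Polynomial.eval₂_C,
          Polynomial.coe_eval₂RingHom, Polynomial.eval₂_C, RingHom.coe_coe, MvPolynomial.aeval_X]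
      · rw [Fin.snoc_last, Fin.snoc_last, Polynomial.coe_eval₂RingHom, Polynomial.eval₂_X]

/-- **Tower map 2** (`y_last ↦ U` middle, `x_last ↦ V` outer) is compatible with gluing:
evaluating at `X_τ ↦ p`, `U ↦ b`, `V ↦ a` gives `H(glue(p, a, b))`. [folklore] -/
theorem aeval_fibreLift₂ (p : Fin d ⊕ Fin d → L) (a b : L)
    (H : MvPolynomial (Fin (d + 1) ⊕ Fin (d + 1)) F) :
    (Polynomial.eval₂RingHom (Polynomial.eval₂RingHom
        (MvPolynomial.aeval (R := F) p : MvPolynomial (Fin d ⊕ Fin d) F →+* L) b) a)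
      (MvPolynomial.aeval (R := F)
        (Sum.elim (Fin.snoc (fun i => Polynomial.C (Polynomial.C (X (Sum.inl i)))) Polynomial.X)
          (Fin.snoc (fun i => Polynomial.C (Polynomial.C (X (Sum.inr i)))) (Polynomial.C Polynomial.X)) :
          Fin (d + 1) ⊕ Fin (d + 1) → Polynomial (Polynomial (MvPolynomial (Fin d ⊕ Fin d) F))) H) =
    MvPolynomial.aeval (Sum.elim (Fin.snoc (fun i => p (Sum.inl i)) a)
        (Fin.snoc (fun i => p (Sum.inr i)) b) : Fin (d + 1) ⊕ Fin (d + 1) → L) H := by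
  revert H
  refine fun H => DFunLike.congr_fun (f := (Polynomial.eval₂RingHom (Polynomial.eval₂RingHom
        (MvPolynomial.aeval (R := F) p : MvPolynomial (Fin d ⊕ Fin d) F →+* L) b) a).comp
      (MvPolynomial.aeval (R := F)
        (Sum.elim (Fin.snoc (fun i => Polynomial.C (Polynomial.C (X (Sum.inl i)))) Polynomial.X)
          (Fin.snoc (fun i => Polynomial.C (Polynomial.C (X (Sum.inr i)))) (Polynomial.C Polynomial.X)) :
          Fin (d + 1) ⊕ Fin (d + 1) → Polynomial (Polynomial (MvPolynomial (Fin d ⊕ Fin d) F))) :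
            MvPolynomial (Fin (d + 1) ⊕ Fin (d + 1)) F →+* _))
    (g := (MvPolynomial.aeval (R := F) (Sum.elim (Fin.snoc (fun i => p (Sum.inl i)) a)
        (Fin.snoc (fun i => p (Sum.inr i)) b) : Fin (d + 1) ⊕ Fin (d + 1) → L) : _ →+* L)) ?_ H
  refine MvPolynomial.ringHom_ext (fun c => ?_) (fun j => ?_)
  · rw [RingHom.comp_apply, RingHom.coe_coe, RingHom.coe_coe, MvPolynomial.aeval_C,
      MvPolynomial.aeval_C, Polynomial.algebraMap_apply, Polynomial.algebraMap_apply,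
      MvPolynomial.algebraMap_eq, Polynomial.coe_eval₂RingHom, Polynomial.eval₂_C,
      Polynomial.coe_eval₂RingHom, Polynomial.eval₂_C, RingHom.coe_coe, MvPolynomial.aeval_C]
  · rw [RingHom.comp_apply, RingHom.coe_coe, RingHom.coe_coe, MvPolynomial.aeval_X,
      MvPolynomial.aeval_X]
    rcases j with k | k
    · simp only [Sum.elim_inl]
      rcases Fin.eq_castSucc_or_eq_last k with ⟨i, rfl⟩ | rfl
      · rw [Fin.snoc_castSucc, Fin.snoc_castSucc, Polynomial.coe_eval₂RingHom, Polynomial.eval₂_C,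
          Polynomial.coe_eval₂RingHom, Polynomial.eval₂_C, RingHom.coe_coe, MvPolynomial.aeval_X]
      · rw [Fin.snoc_last, Fin.snoc_last, Polynomial.coe_eval₂RingHom, Polynomial.eval₂_X]
    · simp only [Sum.elim_inr]
      rcases Fin.eq_castSucc_or_eq_last k with ⟨i, rfl⟩ | rfl
      · rw [Fin.snoc_castSucc, Fin.snoc_castSucc, Polynomial.coe_eval₂RingHom, Polynomial.eval₂_C,
          Polynomial.coe_eval₂RingHom, Polynomial.eval₂_C, RingHom.coe_coe, MvPolynomial.aeval_X]
      · rw [Fin.snoc_last, Fin.snoc_last, Polynomial.coe_eval₂RingHom, Polynomial.eval₂_C,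
          Polynomial.coe_eval₂RingHom, Polynomial.eval₂_X]

end Glue

/-! ## The fibre over a small point is Zariski closed -/

section Fibre

/-- **The fibre is Zariski closed.**  For an ideal `P ⊆ F[X_σ]` and a small point `p ∈ F^τ`, the set of
`w ∈ F^{1} × F^{1}` whose glued point `glue(p, w₀, w₁)` lies in `Z(P)` is the zero locus of the image
of `P` under the substitution `X_τ ↦ p`, `x_last ↦ X₀`, `y_last ↦ Y₀`. [folklore] -/
theorem isZariskiClosed_fibre (P : Ideal (MvPolynomial (Fin (d + 1) ⊕ Fin (d + 1)) F))
    (p : Fin d ⊕ Fin d → F) :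
    IsZariskiClosed F {w : Fin 1 ⊕ Fin 1 → F |
      (Sum.elim (Fin.snoc (fun i => p (Sum.inl i)) (w (Sum.inl 0)))
        (Fin.snoc (fun i => p (Sum.inr i)) (w (Sum.inr 0))) : Fin (d + 1) ⊕ Fin (d + 1) → F) ∈
          zeroLocus F P} := by
  -- the substitution
  let κ : Fin (d + 1) ⊕ Fin (d + 1) → MvPolynomial (Fin 1 ⊕ Fin 1) F :=
    Sum.elim (Fin.snoc (fun i => C (p (Sum.inl i))) (X (Sum.inl 0)))
      (Fin.snoc (fun i => C (p (Sum.inr i))) (X (Sum.inr 0)))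
  refine ⟨Ideal.map (MvPolynomial.aeval (R := F) κ) P, ?_⟩
  have hκ : ∀ w : Fin 1 ⊕ Fin 1 → F, (fun j => MvPolynomial.aeval w (κ j)) =
      (Sum.elim (Fin.snoc (fun i => p (Sum.inl i)) (w (Sum.inl 0)))
        (Fin.snoc (fun i => p (Sum.inr i)) (w (Sum.inr 0))) : Fin (d + 1) ⊕ Fin (d + 1) → F) := by
    intro w
    funext j
    rcases j with k | k
    · simp only [κ, Sum.elim_inl]
      rcases Fin.eq_castSucc_or_eq_last k with ⟨i, rfl⟩ | rfl
      · rw [Fin.snoc_castSucc, Fin.snoc_castSucc, MvPolynomial.aeval_C]; rfl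
      · rw [Fin.snoc_last, Fin.snoc_last, MvPolynomial.aeval_X]
    · simp only [κ, Sum.elim_inr]
      rcases Fin.eq_castSucc_or_eq_last k with ⟨i, rfl⟩ | rfl
      · rw [Fin.snoc_castSucc, Fin.snoc_castSucc, MvPolynomial.aeval_C]; rfl
      · rw [Fin.snoc_last, Fin.snoc_last, MvPolynomial.aeval_X]
  have hcomp : ∀ (w : Fin 1 ⊕ Fin 1 → F) (H : MvPolynomial (Fin (d + 1) ⊕ Fin (d + 1)) F),
      MvPolynomial.aeval w (MvPolynomial.aeval κ H) =
        MvPolynomial.aeval (Sum.elim (Fin.snoc (fun i => p (Sum.inl i)) (w (Sum.inl 0)))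
          (Fin.snoc (fun i => p (Sum.inr i)) (w (Sum.inr 0))) : Fin (d + 1) ⊕ Fin (d + 1) → F) H := by
    intro w H
    rw [← hκ w, ← MvPolynomial.comp_aeval, AlgHom.comp_apply]
  ext w
  simp only [Set.mem_setOf_eq]
  rw [Ideal.map, zeroLocus_span, Set.mem_setOf_eq, mem_zeroLocus_iff]
  constructor
  · intro hw g hg
    obtain ⟨H, hH, rfl⟩ := hg
    rw [hcomp]
    exact hw H hH
  · intro hw H hH
    rw [← hcomp]
    exact hw _ ⟨H, hH, rfl⟩

end Fibre

/-! ## One-variable finiteness -/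

section OneVar

/-- A polynomial in the single variable `X₀ ∈ F[X_{Fin 1}]` with infinitely many zeros is zero.
[folklore] -/
theorem eq_zero_of_infinite_eval_eq_zero (f : MvPolynomial (Fin 1) F)
    (h : Set.Infinite {t : F | MvPolynomial.eval (fun _ => t) f = 0}) : f = 0 := by
  -- pass to `F[X]` through `finSuccEquiv F 0` and `eval Fin.elim0 : F[X_{Fin 0}] ≃ F`
  set g : Polynomial F := (finSuccEquiv F 0 f).map (MvPolynomial.eval Fin.elim0) with hg
  have hfg : ∀ t : F, MvPolynomial.eval (fun _ => t) f = g.eval t := by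
    intro t
    have h1 : (fun _ : Fin 1 => t) = Fin.cons t Fin.elim0 := by
      funext i
      rw [Fin.fin_one_eq_zero i, Fin.cons_zero]
    rw [h1, MvPolynomial.eval_eq_eval_mv_eval']
  have hg0 : g = 0 := by
    refine Polynomial.eq_zero_of_infinite_isRoot g (h.mono ?_)
    intro t ht
    simp only [Set.mem_setOf_eq] at ht ⊢
    rw [Polynomial.IsRoot.def, ← hfg]
    exact ht
  -- `map (eval Fin.elim0)` and `finSuccEquiv` are injective
  have hinj : Function.Injective (MvPolynomial.eval (Fin.elim0 : Fin 0 → F)) := by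
    intro q₁ q₂ hq
    rw [MvPolynomial.eq_C_of_isEmpty q₁, MvPolynomial.eq_C_of_isEmpty q₂] at hq ⊢
    rw [MvPolynomial.eval_C, MvPolynomial.eval_C] at hq
    rw [hq]
  have h2 : finSuccEquiv F 0 f = 0 := by
    apply Polynomial.map_injective _ hinj
    rw [Polynomial.map_zero]
    exact hg0
  exact (finSuccEquiv F 0).injective (by rw [h2, map_zero])

/-- **Dominance from infinitely many first coordinates.**  A subset `V ⊆ F^{1} × F^{1}` whose points
have infinitely many distinct additive coordinates has dominant additive projection. [folklore] -/
theorem hasDominantAddProjection_of_infinite_fst {V : Set (Fin 1 ⊕ Fin 1 → F)}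
    (h : Set.Infinite {t : F | ∃ w ∈ V, w (Sum.inl 0) = t}) :
    HasDominantAddProjection F V := by
  intro f hf
  refine eq_zero_of_infinite_eval_eq_zero f (h.mono ?_)
  rintro t ⟨w, hw, rfl⟩
  simp only [Set.mem_setOf_eq]
  have : (fun _ : Fin 1 => w (Sum.inl 0)) = projAdd w := by
    funext i
    rw [Fin.fin_one_eq_zero i, projAdd_apply]
  rw [this]
  exact hf w hw

end OneVar

end Summit.Schanuel.Schanuel.Theorems
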